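import Literature.Analysis.FunctionSpaces.TorusTransportFluxSymm
import Literature.Analysis.FunctionSpaces.TorusTranslationEstimate
import Literature.Analysis.FunctionSpaces.TorusMollifier
import Mathlib.MeasureTheory.Group.Prod
import HarnessLib

/-!
# The weighted transport flux: the LIPSCHITZ bound `|Fl(ω)| ≤ ¼ · Lip(b) · M₃(∇K_ω) · ‖∇w‖²`

Analysis/FunctionSpaces support file (everything proved; no definitions, no named facts).  Concludes
`TorusTransportFluxKernel` / `TorusTransportFluxSymm`: from the double-difference form
`Fl(ω) = −¼ ∫∫ |w(x) − w(y)|² (b(y) − b(x))·∇K_ω(y − x) dx dy` of the transport flux of the weighted Galerkin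
identity (`w ∈ L²(𝕋^d;ℝ^d)`, `b` continuous and weakly divergence free, `ω` real on a finite `F`), a drift with
`‖b(x) − b(y)‖ ≤ L ‖reprc(x − y)‖`, the measure-preserving shear `(x, y) ↦ (x, y − x)` and the `L²` translation
estimate `∫ |w(· + z) − w|² ≤ ‖reprc z‖² ‖∇w‖²` (`TorusTranslationEstimate`, DiPerna–Lions' difference quotient) give

  `|Fl(ω)| ≤ ¼ · L · (eGradNormSq w).toReal · ∫ ‖reprc z‖³ Σ_a |∇K_ω(z)_a| dz`

(`abs_weightedFlux_le_of_lipschitz`).  The constant is the LIPSCHITZ constant of the drift — its strain rate —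
and NOT a Wiener norm of its Fourier coefficients (contrast `Fourier/LatticeTransportFluxSymm.abs_weightedFlux_le`):
this is the form that survives the phase modulation of a Lagrangian (pushed-forward) carrier, whose gradient Wiener
norm is inflated by the square root of the modulation depth.  The remaining analytic input for a dissipation-scale
weight `ω(k) = Ψ(ε²|k|²)` is the kernel moment `∫ ‖reprc z‖³ |∇K_ω(z)| dz ≲ ε²`.

Consumer: cell `ad-ideate`, K1L_D `stmt-AnomalousDissipation-27980`, W3-E `stub_effectiveFrameEnergyL` (i) (two-weight
Lyapunov functional along the Lagrangian carrier; crux memo `Lines/onelevel-W3E-k3l-lyapunov.md`, re-plan P1).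

## Mathlib / tree search
Tree: `TorusTransportFluxSymm.weightedFlux_eq_neg_quarter_integral`, `TorusTranslationEstimate.lintegral_enorm_sub_translate_sq_le`,
`TorusMollifier` (`reprc`, `proj_reprc`, `abs_reprc_apply_le`, `measurable_reprc`), `TorusTransportFluxKernel.abs_fluxKernelGrad_le`.
Mathlib: `measurePreserving_prod_sub`, `MeasurableEquiv.shearSubRight`, `MeasurePreserving.lintegral_comp_emb`,
`lintegral_prod_symm`, `quasiMeasurePreserving_add`, `norm_integral_le_lintegral_norm`, `integral_eq_lintegral_of_nonneg_ae`.

## References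
* R. J. DiPerna, P.-L. Lions, Invent. Math. 98 (1989), §II.1, Lemma II.1. [`DiPernaLions1989`]
* P. Constantin, W. E, E. S. Titi, Comm. Math. Phys. 165 (1994), (9)–(10). [`ConstantinETiti1994`]
-/

noncomputable section

open MeasureTheory Set Filter Complex UnitAddTorus Function
open scoped ENNReal InnerProductSpace ComplexConjugate

namespace Literature.Analysis.FunctionSpaces

namespace Torus

variable {d : Type*} [Fintype d]

section Bound

variable {w b : UnitAddTorus d → EuclideanSpace ℝ d}

/-- `|v_a| ≤ ‖v‖` on `ℝ^d` (file-local). [folklore] -/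
private theorem abs_apply_le_norm' (v : EuclideanSpace ℝ d) (a : d) : |v a| ≤ ‖v‖ := by
  have h := PiLp.norm_apply_le v a
  rwa [Real.norm_eq_abs] at h

/-- `‖reprc z‖ ≤ card d` (each centred coordinate is at most `½`). [folklore] -/
private theorem norm_reprc_le_card (z : UnitAddTorus d) : ‖reprc z‖ ≤ Fintype.card d := by
  classical
  rw [EuclideanSpace.norm_eq]
  have h1 : ∑ i, ‖reprc z i‖ ^ 2 ≤ ∑ _i : d, (1 : ℝ) := Finset.sum_le_sum fun i _ => by
    rw [Real.norm_eq_abs]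
    have := abs_reprc_apply_le z i
    nlinarith [abs_nonneg (reprc z i)]
  rw [Finset.sum_const, Finset.card_univ, nsmul_eq_mul, mul_one] at h1
  calc Real.sqrt (∑ i, ‖reprc z i‖ ^ 2) ≤ Real.sqrt (Fintype.card d) := Real.sqrt_le_sqrt h1
    _ ≤ Fintype.card d := by
        rw [Real.sqrt_le_left (Nat.cast_nonneg _)]
        have : (1 : ℝ) ≤ Fintype.card d ∨ Fintype.card d = 0 := by
          rcases Nat.eq_zero_or_pos (Fintype.card d) with h | h
          · right; exact_mod_cast h
          · left; exact_mod_cast h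
        rcases this with h | h
        · nlinarith
        · rw [show (Fintype.card d : ℝ) = 0 by exact_mod_cast h]; norm_num

/-- **THE LIPSCHITZ BOUND of the weighted transport flux.**  For `w ∈ L² ∩ H¹` (`eGradNormSq w < ∞`), a continuous,
weakly divergence-free drift with `‖b(x) − b(y)‖ ≤ L‖reprc(x − y)‖`, and any finitely supported real weight:
`|Σ_k ω_k Re Σ_a 2πi k_a ⟪𝓕(b_a w)(k), ŵ(k)⟫| ≤ ¼ · L · ‖∇w‖² · Σ_a ∫ ‖reprc z‖³ |∇K_ω(z)_a| dz`
(`‖∇w‖² = (eGradNormSq w).toReal`; double-difference form, `|b(y) − b(x)| ≤ L‖reprc(y−x)‖`, shear `(x, y) ↦ (x, y − x)`,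
and the translation estimate `∫|w(· + z) − w|² ≤ ‖reprc z‖²‖∇w‖²`) — the constant is the Lipschitz constant of the
drift, not a Wiener norm of its coefficients. [cite: DiPernaLions1989, §II.1 Lemma II.1] [cite: ConstantinETiti1994, (9)–(10)] -/
theorem abs_weightedFlux_le_of_lipschitz (hw : MemLp w 2 volume) (hgrad : eGradNormSq w ≠ ⊤) (hb : Continuous b)
    (hdiv : IsWeaklyDivFree b) {L : ℝ} (hL0 : 0 ≤ L) (hL : ∀ x y, ‖b x - b y‖ ≤ L * ‖reprc (x - y)‖)
    (F : Finset (d → ℤ)) (ω : (d → ℤ) → ℝ) :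
    |∑ k ∈ F, ω k * (∑ a, (2 * Real.pi * I * (k a : ℂ)) *
        ⟪mFourierCoeff (EuclideanSpace.complexify ∘ fun x => b x a • w x) k,
          mFourierCoeff (EuclideanSpace.complexify ∘ w) k⟫_ℂ).re| ≤
      1 / 4 * L * (eGradNormSq w).toReal * ∫ z, ‖reprc z‖ ^ 3 * ∑ a, |fluxKernelGrad F ω a z| := by
  rw [weightedFlux_eq_neg_quarter_integral hw hb hdiv, abs_mul, show |(-(1 / 4) : ℝ)| = 1 / 4 by norm_num]
  -- names
  set g : UnitAddTorus d × UnitAddTorus d → ℝ := fun z => ∑ a, (b z.2 a - b z.1 a) * fluxKernelGrad F ω a (z.2 - z.1)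
    with hg
  set ρ : UnitAddTorus d → ℝ := fun u => L * (‖reprc u‖ * ∑ a, |fluxKernelGrad F ω a u|) with hρ
  have hρ0 : ∀ u, 0 ≤ ρ u := fun u =>
    mul_nonneg hL0 (mul_nonneg (norm_nonneg _) (Finset.sum_nonneg fun a _ => abs_nonneg _))
  have hGm : ∀ a, Measurable (fluxKernelGrad F ω a) := fun a => (continuous_fluxKernelGrad F ω a).measurable
  have hρm : Measurable ρ :=
    measurable_const.mul (measurable_reprc.norm.mul (Finset.measurable_sum _ fun a _ =>
      continuous_abs.measurable.comp (hGm a)))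
  -- a uniform bound for `ρ u ‖reprc u‖²`
  obtain ⟨Cρ, hCρ⟩ : ∃ C : ℝ, ∀ u, ρ u * ‖reprc u‖ ^ 2 ≤ C := by
    refine ⟨L * ((Fintype.card d : ℝ) * ∑ a, ∑ k ∈ F, |ω k| * (2 * Real.pi * |(k a : ℝ)|)) * (Fintype.card d : ℝ) ^ 2,
      fun u => ?_⟩
    have h1 : ρ u ≤ L * ((Fintype.card d : ℝ) * ∑ a, ∑ k ∈ F, |ω k| * (2 * Real.pi * |(k a : ℝ)|)) :=
      mul_le_mul_of_nonneg_left (mul_le_mul (norm_reprc_le_card u)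
        (Finset.sum_le_sum fun a _ => abs_fluxKernelGrad_le F ω a u) (Finset.sum_nonneg fun a _ => abs_nonneg _)
        (Nat.cast_nonneg _)) hL0
    have h2 : ‖reprc u‖ ^ 2 ≤ (Fintype.card d : ℝ) ^ 2 := pow_le_pow_left₀ (norm_nonneg _) (norm_reprc_le_card u) 2
    exact mul_le_mul h1 h2 (sq_nonneg _) ((hρ0 u).trans h1)
  -- pointwise bound `|g z| ≤ ρ (z.2 − z.1)`
  have hg_le : ∀ z, |g z| ≤ ρ (z.2 - z.1) := by
    intro z
    refine (Finset.abs_sum_le_sum_abs _ _).trans ?_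
    rw [hρ]
    dsimp only
    rw [Finset.mul_sum, Finset.mul_sum]
    refine Finset.sum_le_sum fun a _ => ?_
    rw [abs_mul]
    have h1 : |b z.2 a - b z.1 a| ≤ L * ‖reprc (z.2 - z.1)‖ := by
      have : |(b z.2 - b z.1) a| ≤ ‖b z.2 - b z.1‖ := abs_apply_le_norm' _ a
      rw [PiLp.sub_apply] at this
      exact this.trans (hL _ _)
    calc |b z.2 a - b z.1 a| * |fluxKernelGrad F ω a (z.2 - z.1)|
        ≤ (L * ‖reprc (z.2 - z.1)‖) * |fluxKernelGrad F ω a (z.2 - z.1)| :=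
          mul_le_mul_of_nonneg_right h1 (abs_nonneg _)
      _ = L * (‖reprc (z.2 - z.1)‖ * |fluxKernelGrad F ω a (z.2 - z.1)|) := by ring
  -- Step 1: `|∫ D| ≤ (∫⁻ |D|).toReal`
  have h1 : |∫ z : UnitAddTorus d × UnitAddTorus d, ‖w z.1 - w z.2‖ ^ 2 * g z| ≤
      (∫⁻ z : UnitAddTorus d × UnitAddTorus d, ENNReal.ofReal (‖w z.1 - w z.2‖ ^ 2 * |g z|)).toReal := by
    have := norm_integral_le_lintegral_norm (μ := (volume : Measure (UnitAddTorus d × UnitAddTorus d)))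
      (fun z : UnitAddTorus d × UnitAddTorus d => ‖w z.1 - w z.2‖ ^ 2 * g z)
    rw [Real.norm_eq_abs] at this
    refine this.trans (le_of_eq ?_)
    congr 1
    refine lintegral_congr fun z => ?_
    rw [Real.norm_eq_abs, abs_mul, abs_of_nonneg (sq_nonneg _)]
  -- measurability of the sheared integrand
  have hψm : AEMeasurable (fun z : UnitAddTorus d × UnitAddTorus d => ‖w z.1 - w (z.1 + z.2)‖ₑ ^ 2 * ENNReal.ofReal (ρ z.2))
      ((volume : Measure (UnitAddTorus d)).prod volume) := by
    have hw1 : AEStronglyMeasurable (fun z : UnitAddTorus d × UnitAddTorus d => w z.1) (volume.prod volume) :=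
      hw.1.comp_quasiMeasurePreserving Measure.quasiMeasurePreserving_fst
    have hw2 : AEStronglyMeasurable (fun z : UnitAddTorus d × UnitAddTorus d => w (z.1 + z.2)) (volume.prod volume) :=
      hw.1.comp_quasiMeasurePreserving (quasiMeasurePreserving_add volume volume)
    exact ((hw1.sub hw2).enorm.pow_const 2).mul (hρm.comp measurable_snd).ennreal_ofReal.aemeasurable
  -- Step 2: the lintegral bound
  have h2 : ∫⁻ z : UnitAddTorus d × UnitAddTorus d, ENNReal.ofReal (‖w z.1 - w z.2‖ ^ 2 * |g z|) ≤
      eGradNormSq w * ∫⁻ u, ENNReal.ofReal (ρ u * ‖reprc u‖ ^ 2) := by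
    calc ∫⁻ z : UnitAddTorus d × UnitAddTorus d, ENNReal.ofReal (‖w z.1 - w z.2‖ ^ 2 * |g z|)
        ≤ ∫⁻ z : UnitAddTorus d × UnitAddTorus d, ‖w z.1 - w z.2‖ₑ ^ 2 * ENNReal.ofReal (ρ (z.2 - z.1)) := by
          refine lintegral_mono fun z => ?_
          rw [ENNReal.ofReal_mul (sq_nonneg _), ENNReal.ofReal_pow (norm_nonneg _), ofReal_norm]
          gcongr
          exact hg_le z
      _ = ∫⁻ z : UnitAddTorus d × UnitAddTorus d, (fun p : UnitAddTorus d × UnitAddTorus d =>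
            ‖w p.1 - w (p.1 + p.2)‖ₑ ^ 2 * ENNReal.ofReal (ρ p.2)) (z.1, z.2 - z.1) := by
          refine lintegral_congr fun z => ?_
          simp only [add_sub_cancel]
      _ = ∫⁻ z : UnitAddTorus d × UnitAddTorus d, ‖w z.1 - w (z.1 + z.2)‖ₑ ^ 2 * ENNReal.ofReal (ρ z.2) := by
          have hT : MeasurePreserving (fun z : UnitAddTorus d × UnitAddTorus d => (z.1, z.2 - z.1))
              (volume : Measure (UnitAddTorus d × UnitAddTorus d)) volume := by
            have := measurePreserving_prod_sub (volume : Measure (UnitAddTorus d)) (volume : Measure (UnitAddTorus d))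
            rwa [← Measure.volume_eq_prod] at this
          have hemb : MeasurableEmbedding (fun z : UnitAddTorus d × UnitAddTorus d => (z.1, z.2 - z.1)) :=
            (MeasurableEquiv.shearSubRight (UnitAddTorus d)).measurableEmbedding
          exact hT.lintegral_comp_emb hemb (fun p : UnitAddTorus d × UnitAddTorus d =>
            ‖w p.1 - w (p.1 + p.2)‖ₑ ^ 2 * ENNReal.ofReal (ρ p.2))
      _ = ∫⁻ u, ∫⁻ x, ‖w x - w (x + u)‖ₑ ^ 2 * ENNReal.ofReal (ρ u) := by
          rw [Measure.volume_eq_prod, lintegral_prod_symm _ hψm]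
      _ = ∫⁻ u, (∫⁻ x, ‖w x - w (x + u)‖ₑ ^ 2) * ENNReal.ofReal (ρ u) := by
          refine lintegral_congr fun u => ?_
          rw [lintegral_mul_const' _ _ ENNReal.ofReal_ne_top]
      _ ≤ ∫⁻ u, (ENNReal.ofReal (‖reprc u‖ ^ 2) * eGradNormSq w) * ENNReal.ofReal (ρ u) := by
          refine lintegral_mono fun u => ?_
          gcongr
          have := lintegral_enorm_sub_translate_sq_le hw (reprc u)
          rw [proj_reprc] at this
          calc ∫⁻ x, ‖w x - w (x + u)‖ₑ ^ 2 = ∫⁻ x, ‖w (x + u) - w x‖ₑ ^ 2 := by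
                refine lintegral_congr fun x => ?_; rw [← neg_sub, enorm_neg]
            _ ≤ ENNReal.ofReal (‖reprc u‖ ^ 2) * eGradNormSq w := this
      _ = eGradNormSq w * ∫⁻ u, ENNReal.ofReal (ρ u * ‖reprc u‖ ^ 2) := by
          rw [← lintegral_const_mul' _ _ hgrad]
          refine lintegral_congr fun u => ?_
          rw [ENNReal.ofReal_mul (hρ0 u)]
          ring
  -- Step 3: finiteness and conversion to real integrals
  have hfin : ∫⁻ u, ENNReal.ofReal (ρ u * ‖reprc u‖ ^ 2) ≠ ⊤ := by
    refine ne_top_of_le_ne_top (b := ∫⁻ _u : UnitAddTorus d, ENNReal.ofReal Cρ) ?_ ?_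
    · rw [lintegral_const]; exact ENNReal.mul_ne_top ENNReal.ofReal_ne_top (measure_ne_top _ _)
    · exact lintegral_mono fun u => ENNReal.ofReal_le_ofReal (hCρ u)
  have hreal : (∫⁻ u, ENNReal.ofReal (ρ u * ‖reprc u‖ ^ 2)).toReal = L * ∫ z, ‖reprc z‖ ^ 3 * ∑ a, |fluxKernelGrad F ω a z| := by
    rw [← integral_const_mul, integral_eq_lintegral_of_nonneg_ae]
    · congr 1
      refine lintegral_congr fun u => ?_
      congr 1
      rw [hρ]
      ring
    · exact ae_of_all _ fun u => mul_nonneg hL0 (mul_nonneg (pow_nonneg (norm_nonneg _) _)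
        (Finset.sum_nonneg fun a _ => abs_nonneg _))
    · exact (measurable_const.mul ((measurable_reprc.norm.pow_const 3).mul
        (Finset.measurable_sum _ fun a _ => continuous_abs.measurable.comp (hGm a)))).aestronglyMeasurable
  have h3 : (∫⁻ z : UnitAddTorus d × UnitAddTorus d, ENNReal.ofReal (‖w z.1 - w z.2‖ ^ 2 * |g z|)).toReal ≤
      (eGradNormSq w).toReal * (L * ∫ z, ‖reprc z‖ ^ 3 * ∑ a, |fluxKernelGrad F ω a z|) := by
    rw [← hreal, ← ENNReal.toReal_mul]
    exact ENNReal.toReal_mono (ENNReal.mul_ne_top hgrad hfin) h2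
  calc 1 / 4 * |∫ z : UnitAddTorus d × UnitAddTorus d, ‖w z.1 - w z.2‖ ^ 2 * g z|
      ≤ 1 / 4 * ((eGradNormSq w).toReal * (L * ∫ z, ‖reprc z‖ ^ 3 * ∑ a, |fluxKernelGrad F ω a z|)) :=
        mul_le_mul_of_nonneg_left (h1.trans h3) (by norm_num)
    _ = 1 / 4 * L * (eGradNormSq w).toReal * ∫ z, ‖reprc z‖ ^ 3 * ∑ a, |fluxKernelGrad F ω a z| := by ring

end Bound

end Torus

end Literature.Analysis.FunctionSpaces

end
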